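import Summits.BirchSwinnertonDyer.Rank1Residual.Additive.GordCycLowerBound
import Summits.BirchSwinnertonDyer.Rank1Residual.Additive.GordCharLeadingTerm
import HarnessLib

/-!
# O7-ord / N10 lower half, Iwasawa currency — CLASS FORMS on Delbourgo's (G)-ordinary cell
# (`p ≥ 5`, non-CM), with Delbourgo 2002 Thm. (A)+(B) as the explicit binder A175
# (cell `b2b-bsdres`, team n1011, seat p01, OWNERS row T-O7; companion of `GordCycLowerBound.lean`)

HONEST FRAMING (cell `b2b-bsdres`, run/shared/lean/b2b/bsd-rank1-residual/, verbatim in every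
file): prove what is provable now; shrink each hard class to its core with data; no claim beyond
stated classes. Research routes; census output = EVIDENCE / conjecture items, never a Literature
fact; RESIDUAL-MAP marks change only by signed lines. §I O7 stays OPEN, N10 stays CONSTRUCTION;
X3/X4 stay CONSTRUCTION-SHAPED; nothing is booked; no label changes. Theorems only (no definition,
no named fact): the published input Delbourgo, J. Number Theory 95 (2002) Thm. (A)+(B) enters ONLY
as the explicit binder `Literature.….Delbourgo2002.mainTheorem` (A175, p248323; no `_holds`).

What: `GordCycLowerBound.lean` types the missing input `CycLowerBoundAt W p Dh` ("the `p`-adic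
analytic leading term `q · Reg_p` DIVIDES the algebraic leading term of `X(E/ℚ_∞)`") and proves,
class-agnostically, that together with the clauses of Delbourgo 2002 (B) for the same height datum,
(A)-torsion, Schneider non-degeneracy (rank 1 only) and Gross–Zagier–Kolyvagin it yields — and on
the non-anomalous rows is EQUIVALENT to — the lower half `Typed.MissingLowerBoundAt W p`. Here the
(A)/(B) inputs are discharged from A175 on its printed domain: `p ≥ 5`, `E` without CM, ADDITIVE at
`p` (`Addv W p` = A175's `¬good ∧ ¬mult` verbatim) of type (G)-ordinary (`TypeGOrd W p` = A175's
hypothesis (G) with unit root, verbatim). Since (B) only asserts the EXISTENCE of a height datum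
satisfying its clauses (Delbourgo's `⟨,⟩_{p,ℚ}` is not constructed in the tree), the rider and the
typed input are taken for EVERY datum satisfying the clauses:
`∀ Dh, LeadingTermClauses W p Dh → SchneiderConjecture Dh ∧ CycLowerBoundAt W p Dh` (rank `0`: the
Schneider clause is automatic and dropped). RANK 0 = ONE INPUT FOR THE TEAM (n1011 lead's N10 ruling
2026-08-21T05:00Z): at `r_an = 0` the typed input `CycLowerBoundAt W p Dh` is, for EVERY datum `Dh`,
LITERALLY EQUIVALENT to additive-p2's rank-0 lower input `CycLowerLeadingTermAt W p`
(`GordCharLeadingTerm.lean`, gen 18) — `cycLowerBoundAt_iff_cycLowerLeadingTermAt_of_rankZero`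
below — so the rank-0 class forms are additive-p2's (`ClassX4Gord.missingLowerBoundAt_rankZero_of_cycLower_of_nonAnomalous`,
…) and this file only adds the `r_an ≤ 1` forms (the rank-1 content). Coverage NOT claimed: `p = 3`, the potentially
multiplicative rows, CM curves, anomalous rows (A175's `TODO(general form)`; the core file applies
verbatim to any extension of A175).

References: [Delbourgo2002] Thm. (A), (B) (p. 40), Hypothesis (p. 39), p. 58; [Delbourgo1998] §2.5
(p. 151); [Miller2011LMS] Def. 1.1.
-/

noncomputable section

open scoped Classical NumberField

open WeierstrassCurve NumberField Literature.NumberTheory.EllipticCurves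
  Literature.NumberTheory.EllipticCurves.Rank1Residual
  Literature.NumberTheory.EllipticCurves.Rank1Residual.Typed
  Literature.NumberTheory.EllipticCurves.Delbourgo2002
  IsDedekindDomain

namespace Summit.BirchSwinnertonDyer.Rank1Residual.Additive

variable (W : WeierstrassCurve ℚ) [W.IsElliptic] [W.IsGloballyMinimal] (p : ℕ) [hp : Fact p.Prime]


/-! ### Rank `0`: the typed input IS additive-p2's `CycLowerLeadingTermAt` (one input for the team) -/

omit [W.IsGloballyMinimal] in
variable {W p} in
/-- **Bridge (rank `0`).** For `W` of analytic rank `0` (so `rank_ℤ E(ℚ) = 0` by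
Gross–Zagier–Kolyvagin, `E(ℚ)` finite, `Reg_∞ = 1`, `Reg_p(Dh) = 1` for every height datum, and
`L^{(0)}(E,1)/0! = L(E,1)`), the rank-uniform typed input `CycLowerBoundAt W p Dh` of
`GordCycLowerBound.lean` is EQUIVALENT, for every `Dh`, to additive-p2's rank-`0` lower input
`CycLowerLeadingTermAt W p` ("`L(E,1)/Ω_E` divides `f(0)` for every generator `f`"). Bookkeeping, so
that the team carries ONE rank-`0` input. [cite: Delbourgo1998, Main Conjecture (p. 151) (shape only)] -/
theorem cycLowerBoundAt_iff_cycLowerLeadingTermAt_of_rankZero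
    (hGZK : rank_eq_analyticRank_of_analyticRank_le_one) (hr : W.analyticRank = 0)
    (Dh : PAdicHeightData W p) : CycLowerBoundAt W p Dh ↔ CycLowerLeadingTermAt W p := by
  obtain ⟨hmw, -⟩ := hGZK W (by rw [hr]; exact zero_le_one)
  have hmw0 : W.mordellWeilRank = 0 := by rw [hmw, hr]
  haveI : Finite W.toAffine.Point := W.finite_point_of_rank_zero hmw0
  have hRegp : padicRegulator Dh = 1 := padicRegulator_eq_one_of_finite W p Dh
  have hReg : W.regulator = 1 := W.regulator_eq_one_of_rank_zero hmw0
  have hlead : W.leadingLCoeff = W.entireLFunction 1 := W.leadingLCoeff_eq_of_analyticRank_eq_zero hr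
  constructor
  · intro h κ γ hκ hγ hγ' D fE hchar
    obtain ⟨q, c, hLq, hcoeff⟩ := h κ γ hκ hγ hγ' D fE hchar
    refine ⟨q, ?_, c, ?_⟩
    · rw [← hlead, hLq, hReg]
      push_cast
      ring
    · rw [hmw0, pow_zero, mul_one, PowerSeries.coeff_zero_eq_constantCoeff, hRegp, mul_one] at hcoeff
      exact hcoeff
  · intro h κ γ hκ hγ hγ' D fE hchar
    obtain ⟨q, hLq, c, hcoeff⟩ := h κ γ hκ hγ hγ' D fE hchar
    refine ⟨q, c, ?_, ?_⟩
    · rw [hlead, hLq, hReg]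
      push_cast
      ring
    · rw [hmw0, pow_zero, mul_one, PowerSeries.coeff_zero_eq_constantCoeff, hRegp, mul_one]
      exact hcoeff

/-! ### Class forms on Delbourgo's (G)-ordinary cell, `r_an ≤ 1` (A175 as an explicit binder) -/

/-- **The lower half on Delbourgo's (G)-ordinary cell from the typed input, `r_an ≤ 1`.** For `W`
globally minimal WITHOUT CM, `p ≥ 5` a prime of ADDITIVE reduction (`Addv W p`) of type
(G)-ordinary (`TypeGOrd W p` — Delbourgo's hypothesis (G) with potential good ORDINARY reduction, the
binder of A175 verbatim), `r_an ≤ 1`, non-anomalous reduction over the (G)-fields: granted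
Delbourgo 2002 Thm. (A)+(B) (`hDel`, A175, explicit binder) and Gross–Zagier–Kolyvagin (`hGZK`),
IF for every height datum `Dh` satisfying the clauses of (B) the regulator is non-degenerate
(Delbourgo's rider; per pair a certificate) AND the typed input `CycLowerBoundAt W p Dh` holds,
THEN `Typed.MissingLowerBoundAt W p`. [cite: Delbourgo2002, Theorem (A), (B) (p. 40), Hypothesis (p. 39), p. 58]
[cite: Miller2011LMS, Def. 1.1] -/
theorem missingLowerBoundAt_of_delbourgo2002_of_cycLowerBound (hDel : Delbourgo2002.mainTheorem)
    (hGZK : rank_eq_analyticRank_of_analyticRank_le_one)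
    (hp5 : 5 ≤ p) (hcm : ¬ W.HasCM) (hadd : Addv W p) (hG : TypeGOrd W p) (hr : W.analyticRank ≤ 1)
    (hna : ReductionNonAnomalous W p)
    (hlow : ∀ Dh : PAdicHeightData W p, LeadingTermClauses W p Dh →
      SchneiderConjecture Dh ∧ CycLowerBoundAt W p Dh) :
    MissingLowerBoundAt W p := by
  obtain ⟨Dh, hB⟩ := hDel.exists_leadingTermClauses hp5 hcm hadd hG
  obtain ⟨hS, hlowDh⟩ := hlow Dh hB
  exact missingLowerBoundAt_of_cycLowerBound W p hB hS
    (fun κ γ hκ hγ D ↦ hDel.isTorsion hp5 hcm hadd hG hκ hγ D) hGZK hr hna hlowDh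

variable {W p} in
/-- **X4♯(G-ord), `r_an ≤ 1`, `p ≥ 5`, non-CM, non-anomalous: the lower half from the typed input.**
(`ClassX4Gord = ClassX4 ∧ TypeGOrd`; `ClassX4 = p ≠ 2 ∧ Addv ∧ Irr`.) X4 stays CONSTRUCTION-SHAPED /
O7 OPEN; nothing booked. [cite: Delbourgo2002, Theorem (A), (B) (p. 40)] [cite: Miller2011LMS, Def. 1.1] -/
theorem ClassX4Gord.missingLowerBoundAt_rankLeOne_of_cycLowerBound (hDel : Delbourgo2002.mainTheorem)
    (hGZK : rank_eq_analyticRank_of_analyticRank_le_one) (hX : ClassX4Gord W p)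
    (hp5 : 5 ≤ p) (hcm : ¬ W.HasCM) (hr : W.analyticRank ≤ 1) (hna : ReductionNonAnomalous W p)
    (hlow : ∀ Dh : PAdicHeightData W p, LeadingTermClauses W p Dh →
      SchneiderConjecture Dh ∧ CycLowerBoundAt W p Dh) :
    MissingLowerBoundAt W p :=
  missingLowerBoundAt_of_delbourgo2002_of_cycLowerBound W p hDel hGZK hp5 hcm hX.1.2.1 hX.2 hr hna
    hlow

variable {W p} in
/-- **X3♯(G-ord), `r_an ≤ 1`, `p ≥ 5`, non-CM, non-anomalous: the lower half from the typed input.**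
(`ClassX3Gord = ClassX3 ∧ TypeGOrd`; `ClassX3 = Red ∧ Addv`.) X3 stays CONSTRUCTION-SHAPED / O7 OPEN;
nothing booked. [cite: Delbourgo2002, Theorem (A), (B) (p. 40)] [cite: Miller2011LMS, Def. 1.1] -/
theorem ClassX3Gord.missingLowerBoundAt_rankLeOne_of_cycLowerBound (hDel : Delbourgo2002.mainTheorem)
    (hGZK : rank_eq_analyticRank_of_analyticRank_le_one) (hX : ClassX3Gord W p)
    (hp5 : 5 ≤ p) (hcm : ¬ W.HasCM) (hr : W.analyticRank ≤ 1) (hna : ReductionNonAnomalous W p)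
    (hlow : ∀ Dh : PAdicHeightData W p, LeadingTermClauses W p Dh →
      SchneiderConjecture Dh ∧ CycLowerBoundAt W p Dh) :
    MissingLowerBoundAt W p :=
  missingLowerBoundAt_of_delbourgo2002_of_cycLowerBound W p hDel hGZK hp5 hcm hX.1.2 hX.2 hr hna
    hlow

end Summit.BirchSwinnertonDyer.Rank1Residual.Additive

end
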